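import Summits.Schanuel.Schanuel.Theorems.ZilberEacDegenerateDirectionGuard
import HarnessLib

/-!
# The exponential-polynomial regime, CXXIV: THE GUARD AFTER A MONOMIAL CHANGE

HONEST FRAMING.  Cell `pub-schanuel` (Zilber's Exponential-Algebraic Closedness, case ladder;
host summit Schanuel), seat 2, gen 35.  The guard lemma of file CXVIII in the form needed after
a monomial change `y₁ = Λ^{p} y^{q}` (`q ≥ 1`): along a place `x₀ = s^{-k}`,
`x₁ = Φ(s)s^{-M}` of `F = 0` (`k, M ≥ 1`) and rows `Q_j ∈ ℂ[x₀][x₁]`, not all divisible by `F`,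
the sum `Σ_j Q_j(x(s)) Λ^{pj} y^{qj}` is NONZERO whenever `y ≠ 0` is super-exponentially small,
`|y| ≤ e^{-c₀|s|^{-M}}`, and `Λ ≠ 0` is at most mildly large or small, `|log|Λ|| ≤ ε₁|s|^{-M}`
with an explicit `ε₁ > 0`: the term of least index `j₀` with `F ∤ Q_{j₀}` dominates
(**`eventually_guard_ne_zero_zpow`**).  Used for the pull-back of exponential points by a
`GL₂(ℤ)`-change (O93), where `Λ = e^{x₀'}` has `Re x₀' = o(|x₀'|)` (file CXXIII).  [folklore];
Mantova–Masser's question (PLMS 2024 §1 p. 5) stays OPEN; EC(3,2) OPEN; NOT Schanuel's conjecture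
(neither used nor implied); EAC ⇏ SC.
-/

noncomputable section

open Filter Topology Metric Complex Polynomial
open Literature.NumberTheory.Transcendental Literature.ModelTheory.Zilber
open Literature.ModelTheory.ExponentialFields

set_option linter.dupNamespace false

namespace Summit.Schanuel.Schanuel.Theorems

section GuardMonomialChange

variable (F : ℂ[X][X])

/-- `|Λ|^z ≤ exp(|z|·|log|Λ||)` for `Λ ≠ 0`. [folklore] -/
theorem norm_zpow_le_exp_abs {Λ : ℂ} (hΛ : Λ ≠ 0) (z : ℤ) :
    ‖Λ‖ ^ z ≤ Real.exp (|(z : ℝ)| * |Real.log ‖Λ‖|) := by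
  have hΛn : 0 < ‖Λ‖ := norm_pos_iff.2 hΛ
  rw [← Real.rpow_intCast, Real.rpow_def_of_pos hΛn]
  refine Real.exp_le_exp.2 ?_
  rw [← abs_mul, mul_comm]
  exact le_abs_self _

/-- **THE GUARD AFTER A MONOMIAL CHANGE.**  `F` irreducible of positive `x₁`-degree; a place
`x₀ = s^{-k}`, `x₁ = Φ(s)s^{-M}` (`k, M ≥ 1`); rows `Q_j ∈ ℂ[x₀][x₁]` (the coefficients of
`Q ∈ ℂ[x₀][x₁][Y]`), not all divisible by `F`; `p ∈ ℤ`, `q ≥ 1`, `c₀ > 0`.  There is `ε₁ > 0`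
such that for all small `s ≠ 0` and all `Λ, y ≠ 0` with `|log|Λ|| ≤ ε₁|s|^{-M}` and
`|y| ≤ e^{-c₀|s|^{-M}}`: `Σ_j Q_j(x(s)) Λ^{pj} y^{qj} ≠ 0`. [folklore] (new) -/
theorem eventually_guard_ne_zero_zpow (hFirr : Irreducible F) (hn : 1 ≤ F.natDegree)
    {k : ℕ} (hk : 1 ≤ k) {M : ℕ} (hM : 1 ≤ M) {Φ : ℂ → ℂ} (hΦan : AnalyticAt ℂ Φ 0)
    (hplace : ∀ᶠ s in 𝓝[≠] (0 : ℂ),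
      (F.map (Polynomial.evalRingHom (s ^ k)⁻¹)).eval (Φ s * (s ^ M)⁻¹) = 0)
    (Q : Polynomial ℂ[X][X]) (hQ : ∃ j, ¬ F ∣ Q.coeff j) (p : ℤ) {q : ℤ} (hq : 1 ≤ q)
    {c₀ : ℝ} (hc₀ : 0 < c₀) :
    ∃ ε₁ > (0 : ℝ), ∀ᶠ s in 𝓝[≠] (0 : ℂ), ∀ Λ y : ℂ, Λ ≠ 0 →
      |Real.log ‖Λ‖| ≤ ε₁ * ‖s‖⁻¹ ^ M → y ≠ 0 → ‖y‖ ≤ Real.exp (-(c₀ * ‖s‖⁻¹ ^ M)) →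
      ∑ j ∈ Finset.range (Q.natDegree + 1),
        (Polynomial.eval₂RingHom (Polynomial.evalRingHom (s ^ k)⁻¹) (Φ s * (s ^ M)⁻¹)) (Q.coeff j) *
          Λ ^ (p * (j : ℤ)) * y ^ (q * (j : ℤ)) ≠ 0 := by
  classical
  obtain ⟨d, hd⟩ : ∃ d : ℕ, Q.natDegree = d := ⟨_, rfl⟩
  -- the least index `j₀` with `F ∤ Q_{j₀}`
  obtain ⟨j₀, hj₀, hbelow⟩ : ∃ j₀, ¬ F ∣ Q.coeff j₀ ∧ ∀ j, j < j₀ → F ∣ Q.coeff j := by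
    refine ⟨Nat.find hQ, Nat.find_spec hQ, fun j hj => ?_⟩
    have h := Nat.find_min hQ hj
    push Not at h
    exact h
  have hj₀d : j₀ ≤ d := by
    by_contra h
    exact hj₀ (by rw [Polynomial.coeff_eq_zero_of_natDegree_lt (by omega)]; exact dvd_zero F)
  have hj₀mem : j₀ ∈ Finset.range (d + 1) := Finset.mem_range.2 (by omega)
  -- rows along the place
  have hrow := exists_row_along_place F hFirr hn hk M hΦan hplace
  choose ψ L hψan hψ0 hψev using fun m => hrow (Q.coeff m)
  have hψ00 : ψ j₀ 0 ≠ 0 := hψ0 j₀ hj₀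
  have hψpos : 0 < ‖ψ j₀ 0‖ / 2 := half_pos (norm_pos_iff.2 hψ00)
  obtain ⟨N, hLN⟩ : ∃ N : ℕ, ∀ m ∈ Finset.range (d + 1), -(N : ℤ) ≤ L m ∧ L m ≤ N := by
    refine ⟨(Finset.range (d + 1)).sup fun m => (L m).natAbs, fun m hm => ?_⟩
    have h1 : (L m).natAbs ≤ (Finset.range (d + 1)).sup fun m => (L m).natAbs :=
      Finset.le_sup (f := fun m => (L m).natAbs) hm
    constructor <;> omega
  obtain ⟨A, hA0, hAm⟩ : ∃ A : ℝ, 0 < A ∧ ∀ m ∈ Finset.range (d + 1), ‖ψ m 0‖ + 1 ≤ A := by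
    refine ⟨∑ m ∈ Finset.range (d + 1), (‖ψ m 0‖ + 1), ?_, fun m hm =>
      Finset.single_le_sum (f := fun m => ‖ψ m 0‖ + 1) (fun i _ => by positivity) hm⟩
    exact lt_of_lt_of_le (by positivity) (Finset.single_le_sum (f := fun m => ‖ψ m 0‖ + 1)
      (fun i _ => by positivity) hj₀mem)
  obtain ⟨ε₀, hε₀pos, hε₀⟩ : ∃ ε₀ : ℝ, 0 < ε₀ ∧ (d : ℝ) * A * ε₀ < ‖ψ j₀ 0‖ / 2 := by
    refine ⟨‖ψ j₀ 0‖ / 2 / ((d : ℝ) * A + 1), by positivity, ?_⟩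
    rw [show (d : ℝ) * A * (‖ψ j₀ 0‖ / 2 / ((d : ℝ) * A + 1)) =
      ‖ψ j₀ 0‖ / 2 * ((d : ℝ) * A / ((d : ℝ) * A + 1)) by ring]
    have hlt : (d : ℝ) * A / ((d : ℝ) * A + 1) < 1 := by
      rw [div_lt_one (by positivity)]
      linarith
    calc ‖ψ j₀ 0‖ / 2 * ((d : ℝ) * A / ((d : ℝ) * A + 1)) < ‖ψ j₀ 0‖ / 2 * 1 :=
          mul_lt_mul_of_pos_left hlt hψpos
      _ = ‖ψ j₀ 0‖ / 2 := mul_one _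
  -- the tolerance for `log |Λ|`
  set ε₁ : ℝ := c₀ / (2 * ((|(p : ℝ)|) * d + 1)) with hε₁
  have hε₁pos : 0 < ε₁ := by positivity
  have hε₁le : |(p : ℝ)| * d * ε₁ ≤ c₀ / 2 := by
    have hden : 0 < 2 * (|(p : ℝ)| * d + 1) := by positivity
    rw [hε₁, ← mul_div_assoc, div_le_iff₀ hden]
    have e : c₀ / 2 * (2 * (|(p : ℝ)| * d + 1)) = |(p : ℝ)| * d * c₀ + c₀ := by ring
    rw [e]
    linarith
  -- eventual facts along the place
  have hall : ∀ᶠ s in 𝓝[≠] (0 : ℂ), ∀ m ∈ Finset.range (d + 1),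
      ((Q.coeff m).map (Polynomial.evalRingHom (s ^ k)⁻¹)).eval (Φ s * (s ^ M)⁻¹) =
          ψ m s * s ^ L m ∧ ‖ψ m s‖ ≤ ‖ψ m 0‖ + 1 := by
    refine (Finset.eventually_all _).2 fun m _ => (hψev m).and ?_
    have h1 : Tendsto (ψ m) (𝓝[≠] 0) (𝓝 (ψ m 0)) :=
      (hψan m).continuousAt.tendsto.mono_left nhdsWithin_le_nhds
    filter_upwards [(Metric.tendsto_nhds.1 h1) 1 one_pos] with s hs
    rw [dist_eq_norm] at hs
    linarith [norm_le_norm_add_norm_sub' (ψ m s) (ψ m 0)]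
  have hψhalf : ∀ᶠ s in 𝓝[≠] (0 : ℂ), ‖ψ j₀ 0‖ / 2 ≤ ‖ψ j₀ s‖ := by
    have h1 : Tendsto (ψ j₀) (𝓝[≠] 0) (𝓝 (ψ j₀ 0)) :=
      (hψan j₀).continuousAt.tendsto.mono_left nhdsWithin_le_nhds
    filter_upwards [(Metric.tendsto_nhds.1 h1) _ hψpos] with s hs
    rw [dist_eq_norm] at hs
    linarith [norm_sub_norm_le (ψ j₀ 0) (ψ j₀ s), norm_sub_rev (ψ j₀ 0) (ψ j₀ s)]
  have hsmall1 : ∀ᶠ s in 𝓝[≠] (0 : ℂ), ‖s‖ < 1 := by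
    have h : Tendsto (fun s : ℂ => s) (𝓝[≠] 0) (𝓝 0) := tendsto_id.mono_left nhdsWithin_le_nhds
    filter_upwards [(Metric.tendsto_nhds.1 h) 1 one_pos] with s hs
    rwa [dist_zero_right] at hs
  have hc₀2 : 0 < c₀ / 2 := half_pos hc₀
  have hdec : ∀ᶠ s in 𝓝[≠] (0 : ℂ),
      ‖s‖ ^ (-((N + N : ℕ) : ℤ)) * Real.exp (-(c₀ / 2 * ‖s‖ ^ (-(M : ℤ)))) < ε₀ := by
    have h := (tendsto_zpow_neg_mul_exp_neg hc₀2 hM (N + N)).comp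
      (tendsto_norm_nhdsNE_zero (E := ℂ))
    exact h.eventually (gt_mem_nhds hε₀pos)
  refine ⟨ε₁, hε₁pos, ?_⟩
  filter_upwards [hall, hψhalf, hsmall1, hdec, hplace, self_mem_nhdsWithin]
    with s hrows hhalf hs1 hdecs hFs hs0 Λ y hΛ0 hΛlog hy0 hysmall
  replace hs0 : s ≠ 0 := hs0
  have hsn : 0 < ‖s‖ := norm_pos_iff.2 hs0
  have hzp : ∀ n : ℤ, 0 < ‖s‖ ^ n := fun n => zpow_pos hsn n
  have hΛn : 0 < ‖Λ‖ := norm_pos_iff.2 hΛ0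
  have hyn : 0 < ‖y‖ := norm_pos_iff.2 hy0
  have hΛp : ∀ n : ℤ, 0 < ‖Λ‖ ^ n := fun n => zpow_pos hΛn n
  have hyp : ∀ n : ℤ, 0 < ‖y‖ ^ n := fun n => zpow_pos hyn n
  set X : ℝ := ‖s‖⁻¹ ^ M with hX
  have hX0 : 0 ≤ X := by positivity
  have eX : ‖s‖ ^ (-(M : ℤ)) = X := by rw [hX, zpow_neg, zpow_natCast, inv_pow]
  have hy1 : ‖y‖ ≤ 1 := hysmall.trans (by
    rw [Real.exp_le_one_iff]
    have : 0 ≤ c₀ * X := by positivity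
    linarith)
  -- notation for the evaluated rows
  have hf : ∀ m, (Polynomial.eval₂RingHom (Polynomial.evalRingHom (s ^ k)⁻¹) (Φ s * (s ^ M)⁻¹))
      (Q.coeff m) = ((Q.coeff m).map (Polynomial.evalRingHom (s ^ k)⁻¹)).eval (Φ s * (s ^ M)⁻¹) :=
    fun m => by rw [Polynomial.coe_eval₂RingHom, Polynomial.eval₂_eq_eval_map]
  rw [hd, ← Finset.add_sum_erase _ _ hj₀mem]
  -- the common factor `ΛY₀ = |Λ|^{p j₀} |y|^{q j₀}`
  set ΛY₀ : ℝ := ‖Λ‖ ^ (p * (j₀ : ℤ)) * ‖y‖ ^ (q * (j₀ : ℤ)) with hΛY₀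
  have hΛY₀pos : 0 < ΛY₀ := mul_pos (hΛp _) (hyp _)
  -- the bound for every term other than `j₀`
  set B : ℝ := A * ‖s‖ ^ (-(N : ℤ)) * ΛY₀ * Real.exp (-(c₀ / 2 * X)) with hB
  have hB0 : 0 ≤ B := by
    rw [hB]
    exact (mul_pos (mul_pos (mul_pos hA0 (hzp _)) hΛY₀pos) (Real.exp_pos _)).le
  have hterm : ∀ m ∈ (Finset.range (d + 1)).erase j₀,
      ‖(Polynomial.eval₂RingHom (Polynomial.evalRingHom (s ^ k)⁻¹) (Φ s * (s ^ M)⁻¹))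
          (Q.coeff m) * Λ ^ (p * (m : ℤ)) * y ^ (q * (m : ℤ))‖ ≤ B := by
    intro m hm
    obtain ⟨hmj, hmr⟩ := Finset.mem_erase.1 hm
    rcases lt_or_gt_of_ne hmj with hlt | hgt
    · -- `m < j₀`: the row vanishes on the curve
      obtain ⟨H, hH⟩ := hbelow m hlt
      rw [hf, hH, Polynomial.map_mul, Polynomial.eval_mul, hFs, zero_mul, zero_mul, zero_mul,
        norm_zero]
      exact hB0
    · -- `m > j₀`
      obtain ⟨hrow, hψb⟩ := hrows m hmr
      have hmd : m ≤ d := by have := Finset.mem_range.1 hmr; omega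
      rw [hf, hrow, norm_mul, norm_mul, norm_mul, norm_zpow, norm_zpow, norm_zpow, hB]
      have h1 : ‖ψ m s‖ ≤ A := hψb.trans (hAm m hmr)
      have h2 : ‖s‖ ^ L m ≤ ‖s‖ ^ (-(N : ℤ)) :=
        zpow_le_zpow_right_of_le_one₀ hsn hs1.le (hLN m hmr).1
      -- split the exponents at `j₀`
      have eΛ : ‖Λ‖ ^ (p * (m : ℤ)) = ‖Λ‖ ^ (p * (j₀ : ℤ)) * ‖Λ‖ ^ (p * ((m : ℤ) - j₀)) := by
        rw [← zpow_add₀ hΛn.ne']; congr 1; ring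
      have ey : ‖y‖ ^ (q * (m : ℤ)) = ‖y‖ ^ (q * (j₀ : ℤ)) * ‖y‖ ^ (q * ((m : ℤ) - j₀)) := by
        rw [← zpow_add₀ hyn.ne']; congr 1; ring
      -- `|Λ|^{p(m - j₀)} ≤ e^{|p| d ε₁ X} ≤ e^{c₀ X / 2}`
      have h3 : ‖Λ‖ ^ (p * ((m : ℤ) - j₀)) ≤ Real.exp (c₀ / 2 * X) := by
        refine (norm_zpow_le_exp_abs hΛ0 _).trans (Real.exp_le_exp.2 ?_)
        have hmj₀ : |((p * ((m : ℤ) - j₀) : ℤ) : ℝ)| ≤ |(p : ℝ)| * d := by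
          push_cast
          rw [abs_mul]
          refine mul_le_mul_of_nonneg_left ?_ (abs_nonneg _)
          rw [abs_of_nonneg (by exact_mod_cast (by omega : (0 : ℤ) ≤ (m : ℤ) - j₀))]
          exact_mod_cast (by omega : (m : ℤ) - j₀ ≤ d)
        calc |((p * ((m : ℤ) - j₀) : ℤ) : ℝ)| * |Real.log ‖Λ‖| ≤ |(p : ℝ)| * d * (ε₁ * X) :=
              mul_le_mul hmj₀ hΛlog (abs_nonneg _) (by positivity)
          _ = |(p : ℝ)| * d * ε₁ * X := by ring
          _ ≤ c₀ / 2 * X := mul_le_mul_of_nonneg_right hε₁le hX0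
      -- `|y|^{q(m - j₀)} ≤ |y| ≤ e^{-c₀ X}`
      have h4 : ‖y‖ ^ (q * ((m : ℤ) - j₀)) ≤ Real.exp (-(c₀ * X)) := by
        have hqm : (1 : ℤ) ≤ q * ((m : ℤ) - j₀) := by
          have : (1 : ℤ) ≤ (m : ℤ) - j₀ := by omega
          nlinarith
        calc ‖y‖ ^ (q * ((m : ℤ) - j₀)) ≤ ‖y‖ ^ (1 : ℤ) :=
              zpow_le_zpow_right_of_le_one₀ hyn hy1 hqm
          _ = ‖y‖ := zpow_one _
          _ ≤ Real.exp (-(c₀ * X)) := hysmall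
      have h34 : ‖Λ‖ ^ (p * ((m : ℤ) - j₀)) * ‖y‖ ^ (q * ((m : ℤ) - j₀)) ≤
          Real.exp (-(c₀ / 2 * X)) := by
        calc ‖Λ‖ ^ (p * ((m : ℤ) - j₀)) * ‖y‖ ^ (q * ((m : ℤ) - j₀))
            ≤ Real.exp (c₀ / 2 * X) * Real.exp (-(c₀ * X)) :=
              mul_le_mul h3 h4 (hyp _).le (Real.exp_pos _).le
          _ = Real.exp (-(c₀ / 2 * X)) := by rw [← Real.exp_add]; congr 1; ring
      rw [eΛ, ey]
      calc ‖ψ m s‖ * ‖s‖ ^ L m * (‖Λ‖ ^ (p * (j₀ : ℤ)) * ‖Λ‖ ^ (p * ((m : ℤ) - j₀))) *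
            (‖y‖ ^ (q * (j₀ : ℤ)) * ‖y‖ ^ (q * ((m : ℤ) - j₀)))
          = (‖ψ m s‖ * ‖s‖ ^ L m) * ΛY₀ *
              (‖Λ‖ ^ (p * ((m : ℤ) - j₀)) * ‖y‖ ^ (q * ((m : ℤ) - j₀))) := by rw [hΛY₀]; ring
        _ ≤ (A * ‖s‖ ^ (-(N : ℤ))) * ΛY₀ * Real.exp (-(c₀ / 2 * X)) :=
            mul_le_mul (mul_le_mul_of_nonneg_right (mul_le_mul h1 h2 (hzp _).le hA0.le)
              hΛY₀pos.le) h34 (mul_pos (hΛp _) (hyp _)).le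
              (mul_pos (mul_pos hA0 (hzp _)) hΛY₀pos).le
        _ = B := by rw [hB]
  have hrest : ‖∑ m ∈ (Finset.range (d + 1)).erase j₀,
      (Polynomial.eval₂RingHom (Polynomial.evalRingHom (s ^ k)⁻¹) (Φ s * (s ^ M)⁻¹))
        (Q.coeff m) * Λ ^ (p * (m : ℤ)) * y ^ (q * (m : ℤ))‖ ≤ d * B := by
    refine (norm_sum_le _ _).trans ?_
    have h := Finset.sum_le_card_nsmul _ _ B hterm
    rw [Finset.card_erase_of_mem hj₀mem, Finset.card_range, Nat.add_sub_cancel, nsmul_eq_mul] at h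
    exact h
  -- the main term
  obtain ⟨hrow₀, -⟩ := hrows j₀ hj₀mem
  have hmain : ‖ψ j₀ 0‖ / 2 * ‖s‖ ^ (N : ℤ) * ΛY₀ ≤
      ‖(Polynomial.eval₂RingHom (Polynomial.evalRingHom (s ^ k)⁻¹) (Φ s * (s ^ M)⁻¹))
          (Q.coeff j₀) * Λ ^ (p * (j₀ : ℤ)) * y ^ (q * (j₀ : ℤ))‖ := by
    rw [hf, hrow₀, norm_mul, norm_mul, norm_mul, norm_zpow, norm_zpow, norm_zpow,
      show ‖ψ j₀ s‖ * ‖s‖ ^ L j₀ * ‖Λ‖ ^ (p * (j₀ : ℤ)) * ‖y‖ ^ (q * (j₀ : ℤ)) =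
        ‖ψ j₀ s‖ * ‖s‖ ^ L j₀ * ΛY₀ by rw [hΛY₀]; ring]
    have h2 : ‖s‖ ^ (N : ℤ) ≤ ‖s‖ ^ L j₀ :=
      zpow_le_zpow_right_of_le_one₀ hsn hs1.le (hLN j₀ hj₀mem).2
    exact mul_le_mul_of_nonneg_right (mul_le_mul hhalf h2 (hzp _).le (norm_nonneg _)) hΛY₀pos.le
  -- comparison: `d·B < (|ψ(0)|/2)|s|^N ΛY₀`
  have hcmp : (d : ℝ) * B < ‖ψ j₀ 0‖ / 2 * ‖s‖ ^ (N : ℤ) * ΛY₀ := by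
    have e1 : ‖s‖ ^ (-(N : ℤ)) = ‖s‖ ^ (-((N + N : ℕ) : ℤ)) * ‖s‖ ^ (N : ℤ) := by
      rw [← zpow_add₀ hsn.ne']
      congr 1
      push_cast
      ring
    have h1 : ‖s‖ ^ (-(N : ℤ)) * Real.exp (-(c₀ / 2 * X)) ≤ ε₀ * ‖s‖ ^ (N : ℤ) := by
      rw [e1, ← eX]
      calc ‖s‖ ^ (-((N + N : ℕ) : ℤ)) * ‖s‖ ^ (N : ℤ) * Real.exp (-(c₀ / 2 * ‖s‖ ^ (-(M : ℤ))))
          = ‖s‖ ^ (-((N + N : ℕ) : ℤ)) * Real.exp (-(c₀ / 2 * ‖s‖ ^ (-(M : ℤ)))) * ‖s‖ ^ (N : ℤ) := by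
            ring
        _ ≤ ε₀ * ‖s‖ ^ (N : ℤ) := mul_le_mul_of_nonneg_right hdecs.le (hzp _).le
    have hdA : 0 ≤ (d : ℝ) * A := mul_nonneg (Nat.cast_nonneg _) hA0.le
    have h2 : (d : ℝ) * B ≤ (d : ℝ) * A * ε₀ * (‖s‖ ^ (N : ℤ) * ΛY₀) := by
      rw [hB]
      calc (d : ℝ) * (A * ‖s‖ ^ (-(N : ℤ)) * ΛY₀ * Real.exp (-(c₀ / 2 * X)))
          = (d : ℝ) * A * (‖s‖ ^ (-(N : ℤ)) * Real.exp (-(c₀ / 2 * X))) * ΛY₀ := by ring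
        _ ≤ (d : ℝ) * A * (ε₀ * ‖s‖ ^ (N : ℤ)) * ΛY₀ :=
            mul_le_mul_of_nonneg_right (mul_le_mul_of_nonneg_left h1 hdA) hΛY₀pos.le
        _ = _ := by ring
    have hpos : 0 < ‖s‖ ^ (N : ℤ) * ΛY₀ := mul_pos (hzp _) hΛY₀pos
    calc (d : ℝ) * B ≤ (d : ℝ) * A * ε₀ * (‖s‖ ^ (N : ℤ) * ΛY₀) := h2
      _ < ‖ψ j₀ 0‖ / 2 * (‖s‖ ^ (N : ℤ) * ΛY₀) := mul_lt_mul_of_pos_right hε₀ hpos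
      _ = _ := by ring
  -- conclusion
  intro hsum
  have heq := eq_neg_of_add_eq_zero_left hsum
  have hlt : ‖∑ m ∈ (Finset.range (d + 1)).erase j₀,
      (Polynomial.eval₂RingHom (Polynomial.evalRingHom (s ^ k)⁻¹) (Φ s * (s ^ M)⁻¹))
        (Q.coeff m) * Λ ^ (p * (m : ℤ)) * y ^ (q * (m : ℤ))‖ <
      ‖(Polynomial.eval₂RingHom (Polynomial.evalRingHom (s ^ k)⁻¹) (Φ s * (s ^ M)⁻¹))
          (Q.coeff j₀) * Λ ^ (p * (j₀ : ℤ)) * y ^ (q * (j₀ : ℤ))‖ :=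
    lt_of_le_of_lt hrest (lt_of_lt_of_le hcmp hmain)
  rw [heq, norm_neg] at hlt
  exact lt_irrefl _ hlt

end GuardMonomialChange

end Summit.Schanuel.Schanuel.Theorems

end
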